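import Mathlib
import Summits.QuantumFields.BalabanUV.T4Continuum.Support.SliceCovariantTower
import Summits.QuantumFields.BalabanUV.T4Continuum.Support.SliceCovariantModel

/-!
# T⁴ programme, node NE3 (η-rate of the minimisers) — NE3's typed skeleton, COVARIANT EDITION: the operators are the
# DEFINED covariant objects `G_j = (Δ_U + a_j·Q_j(U)ᵀQ_j(U) + N_j)⁻¹` of `SliceCovariantModel` on the torus
# `(ℤ/NL^k)^d × Cp`, the background enters as an honest parameter (the bond transport matrices), and the
# operator-model binders `hK hτ`, the invertibility and the telescoping identity LEAVE the type

Thirteenth generation of the NE3 prover lineage P1 of the cell `pub-balaban` (technique: implicit-function / fixed-point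
structure of the one-step constrained variational problem, Bałaban CMP 102 (1985) = "B11", Sect. E, read as the DISCRETE
implicit-function theorem = STABILITY × CONSISTENCY).  The tree theorem
`SliceTorusFacesSkeleton.ne3Shape_torusFaces_of_printedStatements` (p195848) states NE3's skeleton in ONE type on the scalar
carrier with FREE matrix binders `G K τ am Ng` tied together by the operator-model hypotheses `hK` (`K_j = massKernel_j +
N_j`), `hτ` (`|τ| ≤ 1`), `ham`; `SliceCovariantModel` (p197588) realised that model for pv21's typed covariant block
averaging (`B9Thm37GlueTorusCov.Comb`, `covMean`, `covLapCov`) on an abstract internal-index type `St × Cp`;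
`SliceCovariantTower` (this generation, file 1/2) moved the torus series to the carrier `TPt d (N·L^k) × Cp`.  THIS FILE
(2/2) is the junction:
 * §1 Bałaban's normalisation on the torus — block weight `wB L d j = (L^j)^{−d}` (the `L^{−jd}` of [B9] (3.19)), mass
   coefficient `aB L d am j = am_j·(L^j)^{d−2}` (mass `am_j·L^{−2j}` times the coarse adjoint factor `(L^j)^d`) — and the
   identity `kPart_eq_massKernel`: for combs whose blocks ARE the torus cubes (`hblk : (Kc j).blk = cube j`) the
   non-Laplacian part `kPart Kc Rm wB aB Ng j` of `SliceCovariantModel` IS the skeleton's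
   `massKernel (cubeI j) (tau (Kc j) Rm) (am_j/(L^j)^{d+2}) + Ng j` — the binder `hK` by `rfl`-bookkeeping, `hτ` by
   `abs_tau_le_one`;
 * §2 `sliceKernel_bound_torusCov_of_printedType`: King's (3.63) shape for every resolvent slice of the DEFINED family
   `gLev`/`kPart` from (3.42)/(3.49) of printed TYPE by name — no `hK`, no `hτ`;
 * §3 **`ne3Shape_torusCov_of_printedStatements`** — THE NE3 SKELETON, COVARIANT EDITION, in one type.  Data per level `k`
   and datum `V`: a bond structure `src k, tgt k : Bd k → (ℤ/NL^k)^d` with non-zero bond weights `c`, ISOMETRIC bond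
   transport matrices `Rm k V` (the background `U` in components — [B9] (3.3) `R(U(b))`), combs `Kc k V j` to the block base
   points whose blocks are the level-`j` cubes (the contours Γ^{(j)}_{y,x} of (3.19)), masses `0 < am ≤ amax`, gauge-fixing
   forms `Ng k V j ⪰ 0`, and the derivative matrix `D k V`.  STABILITY hypotheses = `B9.Thm31Printed` / `B9.Stmt349Printed`
   for the family of matrix carriers of THESE operators (`hA0 : A … 0 U = gLev …`, `hA1`, `hF3`), `hbd`; CONSISTENCY
   hypotheses = those of the scalar skeleton, except that the located reading `hdl` is now stated on a ROW OF `G_k·D` OVER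
   THE UNIT-FACE SKELETON — `dl k V ≤ Σ_{y ∈ faces × Cp} |(G_k·D)(x,y)|`, literally the «double-layer constant of the
   level-k propagator» of `T4TwoSpacingDefect.ConsistencySized` (T2) — and converted INSIDE the proof to the slice sum by
   the resolvent telescoping `SliceCovariantModel.sum_sliceKernel_cov`, whose two-sided inverses are theorems
   (`posDef_kFull`) for every isometric transport.  CONCLUSION unchanged: printed thresholds `M₁, a₀ > 0` exist such that,
   once `M₁ ≤ M`, `Mα₀ ≤ a₀` and every background is in the class (3.35), `NE3Shape R C′ (L^{−a})` for some `C′`.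
WHAT LEFT THE TYPE (relative to p195848): `hK`, `hτ` (theorems), the shape half of `ham` (now `0 < am ≤ amax` on honest
scalars), and — behind `hdl` — the inverse identities `G_j·K_j = 1 = K_j·G_j` of the telescoping.  WHAT ENTERED: the
structural data `hRm` (isometric transport), `hc` (non-zero bond weights), `hNg` (`N_j ⪰ 0`), `hblk` (comb blocks = cubes)
— Bałaban's setting, not analytic readings.  WHAT REMAINS (the located gap, unchanged in nature): the stability READING
(I′)/(I″) that [B9] Theorem 3.1 / (3.49) hold for this family (`hT31`, `hT349`, with `hA0 hA1 hF3 hbd`), and the located,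
UNPRINTED consistency readings `hdl h1 h3 h4 h5 ht hosc hread hresp hpair`.  NOT here (successors): an explicit comb on
`TPt d T` with `blk = cube` (non-vacuity of `hblk`; pv21's `torusComb` is the pattern on the carrier `UT N`), the (3.35)
`Reg335` instance, the flat rung `Rm = 1`.

Honest framing: finite-T⁴ ultraviolet bookkeeping about MINIMISERS (rung (B)+1 of the cell's ladder); no conditional of
the cell (`BetaPertH`, (B), (B^μ)) is used or hidden; nothing bears on infinite volume, a mass gap, or the Clay problem;
**NE3 is NOT proved** — the value is the typed skeleton with three model hypotheses and two inverse identities removed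
from the located gap's one type.  ABSOLUTE RULE of the cell kept: no internally-minted statement enters as a cited fact;
B9's theorems enter only as HYPOTHESES of the tree's typed, cite-tagged shapes; the manuscripts under audit are not cited
for any disputed step.  No `sorry`, no axioms beyond Mathlib's.  PLACEMENT (human rule 2026-08-19): cell work under
`Summits/QuantumFields/BalabanUV/`; imports `Support.SliceCovariantTower` and `Support.SliceCovariantModel`; moves
nothing.  Records: `t4/T4-EST-U1b-OSC.md` v1.25 (RESULT 32), `t4/T4-EST-NE3-P1.md` v2.24, GAPS G-ne3p1-39 of the cell
`pub-balaban`.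
-/

noncomputable section

open Finset Real Matrix

namespace Summit.QuantumFields.BalabanUV.T4Continuum.SliceCovariantSkeleton

open Literature.MathematicalPhysics.QuantumFieldTheory.Balaban1983to89
open Literature.MathematicalPhysics.QuantumFieldTheory.Balaban1983to89.TreeLengthTorus (TPt)
open Literature.MathematicalPhysics.QuantumFieldTheory.Balaban1983to89.B9Thm37GlueTorusCov (Comb)
open Literature.MathematicalPhysics.QuantumFieldTheory.Balaban1983to89.T4SliceTelescoping (sliceKernel sliceConst)
open Literature.MathematicalPhysics.QuantumFieldTheory.Balaban1983to89.T4EtaRateMin (Readings NE3Shape)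
open Literature.MathematicalPhysics.QuantumFieldTheory.Balaban1983to89.T4FixedPointResponse (OneStepCorrectionRate)
open Literature.MathematicalPhysics.QuantumFieldTheory.Balaban1983to89.T4SliceOperatorData
open Summit.QuantumFields.BalabanUV.T4Continuum.SliceTorusBlocks
open Summit.QuantumFields.BalabanUV.T4Continuum.SliceTorusBlockModel
open Summit.QuantumFields.BalabanUV.T4Continuum.SliceTorusTower
open Summit.QuantumFields.BalabanUV.T4Continuum.SliceTorusFaces
open Summit.QuantumFields.BalabanUV.T4Continuum.SliceCovariantModel
open Summit.QuantumFields.BalabanUV.T4Continuum.SliceCovariantTower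

/-! ## §1  Bałaban's normalisation on the torus and the operator model as an identity -/
section Normalisation

/-- Bałaban's BLOCK WEIGHT of the `j`-fold mean, `w_j = (L^j)^{−d}` (the `L^{−jd}` of [B9] (3.19)). [model] [folklore] -/
def wB (L d j : ℕ) : ℝ := (((L : ℝ) ^ j) ^ d)⁻¹

/-- Bałaban's MASS COEFFICIENT in front of `Q_jᵀQ_j`: `a_j = am_j·(L^j)^{−2}·(L^j)^d` (mass `am_j·L^{−2j}` of the level-`j`
averaging term times the coarse-lattice adjoint factor `(L^j)^d`, `Q_j* = (L^j)^d·Q_jᵀ` for the weighted pairings).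
[model] [folklore] -/
def aB (L d : ℕ) (am : ℕ → ℝ) (j : ℕ) : ℝ := am j / ((L : ℝ) ^ j) ^ 2 * ((L : ℝ) ^ j) ^ d

/-- `a_j·w_j² = am_j/(L^j)^{d+2}` — the skeleton's mass coefficient (`SliceCovariantModel.balaban_mass_coeff`). [folklore] -/
theorem aB_mul_wB_sq {L : ℕ} (hL : 0 < L) (d : ℕ) (am : ℕ → ℝ) (j : ℕ) :
    aB L d am j * wB L d j ^ 2 = am j / ((L : ℝ) ^ j) ^ (d + 2) := by
  unfold aB wB
  exact balaban_mass_coeff (by exact_mod_cast hL) (am j) j d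

/-- `w_j ≠ 0`. [folklore] -/
theorem wB_ne_zero {L : ℕ} (hL : 0 < L) (d j : ℕ) : wB L d j ≠ 0 := by
  unfold wB
  have : (0 : ℝ) < ((L : ℝ) ^ j) ^ d := by positivity
  exact inv_ne_zero this.ne'

/-- `0 < a_j` for a positive mass. [folklore] -/
theorem aB_pos {L : ℕ} (hL : 0 < L) (d : ℕ) {am : ℕ → ℝ} {j : ℕ} (ham : 0 < am j) : 0 < aB L d am j := by
  unfold aB
  have hL' : (0 : ℝ) < L := by exact_mod_cast hL
  positivity

variable {d n N L : ℕ} [NeZero N] [NeZero L] {Cp Bd : Type} [Fintype Cp] [DecidableEq Cp]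
  {src tgt : Bd → TPt d (N * L ^ n)}

omit [NeZero N] in
/-- **The operator model as an IDENTITY.**  For combs whose blocks are the level-`j` torus cubes, the non-Laplacian part
`a_j·Q_j(U)ᵀQ_j(U) + N_j` of `SliceCovariantModel` (with Bałaban's normalisation) IS the skeleton's
`massKernel (cubeI j) τ_j (am_j/(L^j)^{d+2}) + N_j` with `τ_j = tau (Kc j) Rm` the transporter overlap — the binder `hK`
of the torus skeleton discharged by bookkeeping, for EVERY transport. [folklore] -/
theorem kPart_eq_massKernel (Kc : ∀ j : ℕ, Comb src tgt (TPt d (levM n N L j))) (Rm : Bd → Cp → Cp → ℝ)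
    (am : ℕ → ℝ) (Ng : ℕ → Matrix (TPt d (N * L ^ n) × Cp) (TPt d (N * L ^ n) × Cp) ℝ)
    (hblk : ∀ j x, (Kc j).blk x = cube d n N L j x) (j : ℕ) :
    kPart Kc Rm (wB L d) (aB L d am) Ng j
      = massKernel (cubeI d n N L Cp j) (tau (Kc j) Rm) (am j / ((L : ℝ) ^ j) ^ (d + 2)) + Ng j := by
  have hL : 0 < L := Nat.pos_of_ne_zero (NeZero.ne L)
  have hfun : (fun p : TPt d (N * L ^ n) × Cp => (Kc j).blk p.1) = cubeI d n N L Cp j :=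
    funext fun p => hblk j p.1
  unfold kPart
  rw [aB_mul_wB_sq hL, hfun]

end Normalisation

/-! ## §2  The slice bounds of printed TYPE for the DEFINED covariant family -/
section PrintedType

variable (d n N L : ℕ) [NeZero N] [NeZero L] (Cp Bd : Type) [Fintype Cp] [DecidableEq Cp] [Fintype Bd]

/-- **THE SLICE BOUNDS `hg` FOR THE COVARIANT FAMILY FROM (3.42)/(3.49) OF PRINTED TYPE** — no operator-model hypothesis.
Data: a bond structure `src tgt`, bond weights `c`, a transport `Rm` (ISOMETRIC, `hRm`), combs `Kc j` with blocks = the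
level-`j` cubes (`hblk`), masses `0 ≤ am_j ≤ amax`, gauge forms `Ng j`, derivative matrix `D`; the resolvent slices are
those of `G_j := gLev Kc c Rm wB aB Ng j = (Δ_U + a_j·Q_jᵀQ_j + N_j)⁻¹` against `K_j := kPart … j`.  HYPOTHESES OF PRINTED
TYPE BY NAME: `h342 : B9.Ineq342_346_347 (matrixFamily (cubeI j) … (A j)) B₀ δ₀ (U j)` with `A j 0 (U j) = G_j`,
`A j 1 (U j) = (G_j·D)ᵀ`, and `h349 : B9.Ineq349 d (fineKernelOf (cubeI j) … (F j)) C₃ δ₁ (U j)` with `F j 3 (U j) = N_j`,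
LEVEL-FREE constants.  CONCLUSION: King's (3.63) shape for every slice with `C_A(1 + C_A·C_P)`.  (`hτ` =
`SliceCovariantModel.abs_tau_le_one`, `hK` = `kPart_eq_massKernel`.)  HONEST: the reading that [B9] Theorem 3.1/3.3 and
(3.49) give `h342`/`h349` for this family is NOT made here. [folklore] -/
theorem sliceKernel_bound_torusCov_of_printedType (Mbig : ℝ)
    (dist : ∀ j : ℕ, TPt d (levM n N L j) → TPt d (levM n N L j) → ℝ)
    (Bg : ℕ → B9.Backgrounds) (U : ∀ j, (Bg j).Cfg)
    (A F : ∀ j, Fin 4 → (Bg j).Cfg → Matrix (TPt d (N * L ^ n) × Cp) (TPt d (N * L ^ n) × Cp) ℝ)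
    (src tgt : Bd → TPt d (N * L ^ n)) (Kc : ∀ j : ℕ, Comb src tgt (TPt d (levM n N L j))) (c : Bd → ℝ)
    (Rm : Bd → Cp → Cp → ℝ) (am : ℕ → ℝ)
    (Ng : ℕ → Matrix (TPt d (N * L ^ n) × Cp) (TPt d (N * L ^ n) × Cp) ℝ)
    (D : Matrix (TPt d (N * L ^ n) × Cp) (TPt d (N * L ^ n) × Cp) ℝ) {B₀ δ₀ C₃ δ₁ δ amax : ℝ}
    (hd : 1 ≤ d) (hB₀ : 0 ≤ B₀) (hC₃ : 0 ≤ C₃) (hδ : 0 ≤ δ) (hδ₀ : δ < δ₀) (hδ₁ : δ ≤ δ₁ / 2) (hamax : 0 ≤ amax)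
    (hRm : ∀ b i j, ∑ k, Rm b k i * Rm b k j = if i = j then (1 : ℝ) else 0)
    (hblk : ∀ j x, (Kc j).blk x = cube d n N L j x)
    (hbd : ∀ j y y₁, (nbd d n N L j y y₁ : ℝ) ≤ dist j y y₁)
    (hA0 : ∀ j, A j 0 (U j) = gLev Kc c Rm (wB L d) (aB L d am) Ng j)
    (hA1 : ∀ j, A j 1 (U j) = (gLev Kc c Rm (wB L d) (aB L d am) Ng j * D).transpose)
    (hF3 : ∀ j, F j 3 (U j) = Ng j)
    (h342 : ∀ j, B9.Ineq342_346_347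
      (matrixFamily (cubeI d n N L Cp j) (dist j) j (L : ℝ) Mbig (A j)) B₀ δ₀ (U j))
    (h349 : ∀ j, B9.Ineq349 d
      (fineKernelOf (cubeI d n N L Cp j) (dist j) j (L : ℝ) Mbig (F j)) C₃ δ₁ (U j))
    (ham : ∀ j, 0 ≤ am j ∧ am j ≤ amax) :
    ∀ i x y, |sliceKernel (gLev Kc c Rm (wB L d) (aB L d am) Ng) (kPart Kc Rm (wB L d) (aB L d am) Ng) D i x y|
      ≤ printedCA B₀ δ₀ δ d ((2 : ℝ) ^ d) d
          * (1 + printedCA B₀ δ₀ δ d ((2 : ℝ) ^ d) d * printedCP amax C₃ δ₁ δ L d d)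
        * (Real.exp (-(δ * (rhoI d n N L Cp x y / (L : ℝ) ^ i))) / ((L : ℝ) ^ i) ^ (d - 1)) :=
  sliceKernel_bound_torusI_of_printedType d n N L Cp Mbig dist Bg U A F
    (gLev Kc c Rm (wB L d) (aB L d am) Ng) Ng (kPart Kc Rm (wB L d) (aB L d am) Ng) D
    (fun j => tau (Kc j) Rm) am hd hB₀ hC₃ hδ hδ₀ hδ₁ hamax hbd hA0 hA1 hF3 h342 h349
    (fun j z w => abs_tau_le_one (Kc j) Rm hRm z w) ham (kPart_eq_massKernel Kc Rm am Ng hblk)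

end PrintedType

/-! ## §3  THE NE3 SKELETON, COVARIANT EDITION, in one type -/
section Skeleton

variable (d N L : ℕ) [NeZero N] [NeZero L] (Cp : Type) [Fintype Cp] [DecidableEq Cp]
  (Bd : ℕ → Type) [∀ k, Fintype (Bd k)]

/-- **NE3's typed skeleton, covariant edition (torus `(ℤ/NL^k)^d × Cp`, printed statements by name, operators DEFINED).**
Level `k` of the RG run lives on the internal-index fine torus `X k = (ℤ/NL^k)^d × Cp`.  DATA per `(k, V)`: a bond structure
`src k, tgt k : Bd k → (ℤ/NL^k)^d` (intended: nearest-neighbour bonds) with bond weights `c k V ≠ 0` of the covariant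
derivative, ISOMETRIC transport matrices `Rm k V` (the background configuration in components, `hRm`), combs `Kc k V j` to
the base points of the level-`j` cubes (`hblk`: their blocks ARE the cubes), masses `0 < am k V j ≤ amax`, gauge-fixing
forms `Ng k V j ⪰ 0` (`hNg`), a derivative matrix `D k V`.  The OPERATORS are then DEFINED: `G k V j :=
SliceCovariantModel.gLev … j = (Δ_U + a_j·Q_j(U)ᵀQ_j(U) + N_j)⁻¹`, `K k V j := kPart … j`, Bałaban-normalised (`wB`, `aB`).
STABILITY HYPOTHESES = the literature seat's `B9.Thm31Printed` and `B9.Stmt349Printed` for the family, indexed by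
`(k, V, j)`, of matrix carriers over the torus block geometries with `A … 0 (U …) = G k V j`, `A … 1 (U …) = (G k V j·D k V)ᵀ`,
`Fk … 3 (U …) = Ng k V j` (reading (I′)/(I″) — HYPOTHESES, never discharged by citation), and `hbd`.  CONSISTENCY
HYPOTHESES = those of `SliceTorusFacesSkeleton.ne3Shape_torusFaces_of_printedStatements` with ONE change: `hdl` reads
«`dl k V` is dominated by a ROW OF `G_k·D` over the unit-face skeleton (with colours)», the telescoped form — converted to
the slice sum inside the proof by `SliceCovariantModel.sum_sliceKernel_cov` (inverses PROVED, `posDef_kFull`).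
CONCLUSION: printed thresholds `M₁, a₀ > 0` exist such that, once `M₁ ≤ M`, `Mα₀ ≤ a₀` and every background `U k V j`
(`V ∈ dom`) is in the class (3.35), `NE3Shape R C′ (L^{−a})` for some `C′`.  GONE from the type: `hK`, `hτ`, the
inverse identities.  HONEST: a SKELETON — NE3 is NOT proved; (W1)/(W2) of the records stay unprinted. [folklore] -/
theorem ne3Shape_torusCov_of_printedStatements {ι : Type} {Xr : Type*} [Fintype Xr] {R : Readings ι Xr} (M c35 : ℝ)
    (Bg : ℕ → ι → ℕ → B9.Backgrounds) (U : ∀ k V j, (Bg k V j).Cfg)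
    (dist : ∀ k j : ℕ, TPt d (levM k N L j) → TPt d (levM k N L j) → ℝ)
    (A Fk : ∀ (k : ℕ) (V : ι) (j : ℕ), Fin 4 → (Bg k V j).Cfg →
      Matrix (TPt d (N * L ^ k) × Cp) (TPt d (N * L ^ k) × Cp) ℝ)
    (src tgt : ∀ k : ℕ, Bd k → TPt d (N * L ^ k))
    (Kc : ∀ (k : ℕ) (_ : ι) (j : ℕ), Comb (src k) (tgt k) (TPt d (levM k N L j)))
    (c : ∀ k : ℕ, ι → Bd k → ℝ) (Rm : ∀ k : ℕ, ι → Bd k → Cp → Cp → ℝ) (am : ℕ → ι → ℕ → ℝ)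
    (Ng : ∀ k : ℕ, ι → ℕ → Matrix (TPt d (N * L ^ k) × Cp) (TPt d (N * L ^ k) × Cp) ℝ)
    (D : ∀ k : ℕ, ι → Matrix (TPt d (N * L ^ k) × Cp) (TPt d (N * L ^ k) × Cp) ℝ)
    {z dl sig blk lam t osc nrm pair : ℕ → ι → ℝ} {CJ CB B CPo CD B0 CR Γ Λr ρ₂ a amax : ℝ}
    (hL : 2 ≤ L) (ha0 : 0 < a) (ha : a < 1) (hd : 2 ≤ d) (hamax : 0 ≤ amax)
    -- the structural data of the covariant family (Bałaban's setting)
    (hRm : ∀ k V b i j, ∑ m, Rm k V b m i * Rm k V b m j = if i = j then (1 : ℝ) else 0)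
    (hc : ∀ k V b, c k V b ≠ 0) (hNg : ∀ k V j, (Ng k V j).PosSemidef)
    (hblk : ∀ k V j x, (Kc k V j).blk x = cube d k N L j x)
    (ham : ∀ k V j, 0 < am k V j ∧ am k V j ≤ amax)
    -- STABILITY: the printed family statements for THIS family (reading (I′)/(I″))
    (hbd : ∀ k j y y₁, (nbd d k N L j y y₁ : ℝ) ≤ dist k j y y₁)
    (hT31 : B9.Thm31Printed c35
      (fun p : ℕ × ι × ℕ => blockGeom (cubeI d p.1 N L Cp p.2.2) (dist p.1 p.2.2) p.2.2 (L : ℝ) M)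
      (fun p : ℕ × ι × ℕ => Bg p.1 p.2.1 p.2.2)
      (fun p : ℕ × ι × ℕ =>
        matrixFamily (cubeI d p.1 N L Cp p.2.2) (dist p.1 p.2.2) p.2.2 (L : ℝ) M (A p.1 p.2.1 p.2.2)))
    (hT349 : B9.Stmt349Printed d c35
      (fun p : ℕ × ι × ℕ => blockGeom (cubeI d p.1 N L Cp p.2.2) (dist p.1 p.2.2) p.2.2 (L : ℝ) M)
      (fun p : ℕ × ι × ℕ => Bg p.1 p.2.1 p.2.2)
      (fun p : ℕ × ι × ℕ =>
        fineKernelOf (cubeI d p.1 N L Cp p.2.2) (dist p.1 p.2.2) p.2.2 (L : ℝ) M (Fk p.1 p.2.1 p.2.2)))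
    (hA0 : ∀ k V j, A k V j 0 (U k V j) = gLev (Kc k V) (c k V) (Rm k V) (wB L d) (aB L d (am k V)) (Ng k V) j)
    (hA1 : ∀ k V j, A k V j 1 (U k V j)
      = (gLev (Kc k V) (c k V) (Rm k V) (wB L d) (aB L d (am k V)) (Ng k V) j * D k V).transpose)
    (hF3 : ∀ k V j, Fk k V j 3 (U k V j) = Ng k V j)
    -- CONSISTENCY: the located readings (unprinted), `hdl` on a row of `G_k·D` over the face skeleton
    (hdl : ∀ k, ∀ V ∈ R.dom, ∃ x : TPt d (N * L ^ k) × Cp,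
      dl k V ≤ ∑ y ∈ faceSkelI d k N L Cp,
        |(gLev (Kc k V) (c k V) (Rm k V) (wB L d) (aB L d (am k V)) (Ng k V) k * D k V) x y|)
    (h1 : ∀ k : ℕ, ∀ V ∈ R.dom, z k V ≤ dl k V * sig k V + blk k V)
    (h3 : ∀ k : ℕ, ∀ V ∈ R.dom, 0 ≤ sig k V ∧ sig k V ≤ CJ * lam k V)
    (h4 : ∀ k : ℕ, ∀ V ∈ R.dom, 0 ≤ blk k V ∧ blk k V ≤ CB * (1 + k * Real.log L) * lam k V)
    (h5 : ∀ k : ℕ, ∀ V ∈ R.dom, 0 ≤ lam k V ∧ lam k V ≤ B * ((L : ℝ)⁻¹ ^ k) ^ 3)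
    (hCJ : 0 ≤ CJ) (hCB : 0 ≤ CB) (hCPo : 0 ≤ CPo) (hCD : 0 ≤ CD) (hB : 0 ≤ B) (hB0 : 0 ≤ B0) (hCR : 0 ≤ CR)
    (hΓ : 0 ≤ Γ) (hΛr : 0 ≤ Λr) (hρ₂ : 0 ≤ ρ₂)
    (ht : ∀ k : ℕ, ∀ V ∈ R.dom, t k V ≤ B0 * CR * (L : ℝ)⁻¹ ^ k)
    (hosc : ∀ k : ℕ, ∀ V ∈ R.dom, osc k V ≤ (1 + CD) * (1 + CPo) * z k V / ((L : ℝ)⁻¹ ^ k) ^ 2 + t k V)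
    (hact : ∀ k : ℕ, ∀ V ∈ R.dom, R.act k V = ∑ x, R.loc k V x) (hvol : (Fintype.card Xr : ℝ) ≤ R.vol)
    (hread : ∀ k : ℕ, ∀ V ∈ R.dom, ∀ x : Xr,
      |R.loc (k + 1) V x - R.loc k V x| ≤ Λr * nrm k V + pair k V)
    (hresp : ∀ k : ℕ, ∀ V ∈ R.dom, nrm k V ≤ Γ * osc k V)
    (hpair : OneStepCorrectionRate R.dom pair ρ₂ ((L : ℝ) ^ (-a))) :
    ∃ M₁ a₀ : ℝ, 0 < M₁ ∧ 0 < a₀ ∧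
      (M₁ ≤ M → ∀ α₀ : ℝ, 0 < α₀ → M * α₀ ≤ a₀ →
        (∀ k V j, V ∈ R.dom → (Bg k V j).Reg335 c35 α₀ (U k V j)) →
          ∃ C' : ℝ, NE3Shape R C' ((L : ℝ) ^ (-a))) := by
  obtain ⟨M₁, δ₀, a₀, B₀, Bβ, Bε, Bεβ, hM₁, hδ₀, ha₀', hB₀, h31⟩ := hT31
  obtain ⟨M₁', δ₁, a₀'', C₃, hM₁', hδ₁, ha₀'', hC₃, h49⟩ := hT349
  refine ⟨max M₁ M₁', min a₀ a₀'', lt_max_of_lt_left hM₁, lt_min ha₀' ha₀'', fun hM α₀ hα₀ hMa hreg => ?_⟩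
  have hLpos : 0 < L := by omega
  have hLr : (1 : ℝ) ≤ L := by exact_mod_cast one_le_L L
  -- the decay rate of the slices: `δ = min(δ₀, δ₁/2)/2`
  set δ : ℝ := min δ₀ (δ₁ / 2) / 2 with hδdef
  have hmin : 0 < min δ₀ (δ₁ / 2) := lt_min hδ₀ (by linarith)
  have hδpos : 0 < δ := by rw [hδdef]; linarith
  have hδ₀' : δ < δ₀ := by
    have h1 : min δ₀ (δ₁ / 2) ≤ δ₀ := min_le_left _ _
    rw [hδdef]; linarith
  have hδ₁' : δ ≤ δ₁ / 2 := by
    have h1 : min δ₀ (δ₁ / 2) ≤ δ₁ / 2 := min_le_right _ _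
    rw [hδdef]; linarith
  -- the level-free slice constant
  set C : ℝ := printedCA B₀ δ₀ δ d ((2 : ℝ) ^ d) d
      * (1 + printedCA B₀ δ₀ δ d ((2 : ℝ) ^ d) d * printedCP amax C₃ δ₁ δ L d d) with hCdef
  have hC : 0 ≤ C := by
    have h1 : 0 ≤ printedCA B₀ δ₀ δ d ((2 : ℝ) ^ d) d := printedCA_nonneg hB₀.le (by positivity) hδ₀'
    have h2 : 0 ≤ printedCP amax C₃ δ₁ δ (L : ℝ) d d := printedCP_nonneg hamax hC₃.le hLr
    rw [hCdef]; positivity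
  -- the printed statements, instantiated: (3.42)/(3.49) of printed TYPE per (k, V ∈ dom, j)
  have h342 : ∀ k, ∀ V ∈ R.dom, ∀ j, B9.Ineq342_346_347
      (matrixFamily (cubeI d k N L Cp j) (dist k j) j (L : ℝ) M (A k V j)) B₀ δ₀ (U k V j) :=
    fun k V hV j => (h31 (k, V, j) (le_trans (le_max_left _ _) hM) α₀ hα₀
      (le_trans hMa (min_le_left _ _)) (U k V j) (hreg k V j hV)).1
  have h349 : ∀ k, ∀ V ∈ R.dom, ∀ j, B9.Ineq349 d
      (fineKernelOf (cubeI d k N L Cp j) (dist k j) j (L : ℝ) M (Fk k V j)) C₃ δ₁ (U k V j) :=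
    fun k V hV j => h49 (k, V, j) (le_trans (le_max_right _ _) hM) α₀ hα₀
      (le_trans hMa (min_le_right _ _)) (U k V j) (hreg k V j hV)
  -- the slice bounds `hg` for the covariant family on every torus level, integer metric `nplI`
  have hg : ∀ k, ∀ V ∈ R.dom, ∀ i < k + 1, ∀ x y : TPt d (N * L ^ k) × Cp,
      |sliceKernel (gLev (Kc k V) (c k V) (Rm k V) (wB L d) (aB L d (am k V)) (Ng k V))
          (kPart (Kc k V) (Rm k V) (wB L d) (aB L d (am k V)) (Ng k V)) (D k V) i x y|
        ≤ C * (Real.exp (-(δ * ((nplI d k N L Cp x y : ℝ) / (L : ℝ) ^ i))) / ((L : ℝ) ^ i) ^ (d - 1)) := by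
    intro k V hV i _ x y
    rw [cast_nplI]
    exact sliceKernel_bound_torusCov_of_printedType d k N L Cp (Bd k) M (dist k) (Bg k V) (U k V) (A k V) (Fk k V)
      (src k) (tgt k) (Kc k V) (c k V) (Rm k V) (am k V) (Ng k V) (D k V) (by omega) hB₀.le hC₃.le hδpos.le hδ₀'
      hδ₁' hamax (hRm k V) (hblk k V) (hbd k) (hA0 k V) (hA1 k V) (hF3 k V) (h342 k V hV) (h349 k V hV)
      (fun j => ⟨(ham k V j).1.le, (ham k V j).2⟩) i x y
  -- the located reading `hdl` on a row of `G_k·D`, TELESCOPED into the slice sum (inverses proved)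
  have hdl' : ∀ k, ∀ V ∈ R.dom, ∃ x : TPt d (N * L ^ k) × Cp,
      dl k V ≤ ∑ y ∈ faceSkelI d k N L Cp, |∑ i ∈ Finset.range (k + 1),
        sliceKernel (gLev (Kc k V) (c k V) (Rm k V) (wB L d) (aB L d (am k V)) (Ng k V))
          (kPart (Kc k V) (Rm k V) (wB L d) (aB L d (am k V)) (Ng k V)) (D k V) i x y| := by
    intro k V hV
    obtain ⟨x, hx⟩ := hdl k V hV
    refine ⟨x, hx.trans (le_of_eq (Finset.sum_congr rfl fun y _ => ?_))⟩
    rw [sum_sliceKernel_cov (hRm k V) (hc k V) (fun j => wB_ne_zero hLpos d j)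
      (fun j => aB_pos hLpos d (ham k V j).1) (hNg k V) (D k V) k x y]
  exact ⟨_, ne3Shape_of_slices_rpow_card0 (fun k => faceSkelI d k N L Cp) (fun k => nplI d k N L Cp)
    (fun k V i => sliceKernel (gLev (Kc k V) (c k V) (Rm k V) (wB L d) (aB L d (am k V)) (Ng k V))
      (kPart (Kc k V) (Rm k V) (wB L d) (aB L d (am k V)) (Ng k V)) (D k V) i)
    (fun k => d * (N * L ^ k)) (by exact_mod_cast hL) ha0 ha hδpos hC
    (mul_nonneg (Nat.cast_nonneg _) faceConst_nonneg : (0 : ℝ) ≤ Fintype.card Cp * faceConst d N) (Nat.cast_nonneg _) (faces_hℓ d N hd) hd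
    (fun k x => card_faceSkelI_zero_le x) (fun k x y _ => nplI_le x y) (faces_hN d N L)
    (fun k x r hr => card_faceSkelI_shell_le hd x r hr) hg hdl' h1 h3 h4 h5 hCJ hCB hCPo hCD hB hB0 hCR hΓ
    hΛr hρ₂ ht hosc hact hvol hread hresp hpair⟩

end Skeleton

end Summit.QuantumFields.BalabanUV.T4Continuum.SliceCovariantSkeleton
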